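import Mathlib
import HarnessLib
import Summits.NavierStokesRegularity.Statement
import Summits.NavierStokesRegularity.NavierStokesRegularity.Theses.ConservativeEngine

/-!
# CONSTANT NORMALISATION for N30's deciding crux X_Eᶜ — Part 1/2: the amplitude–time dilation toolkit

Writer port (decomp-ns-writer-1 g9) of decomp-ns lens 6, generation 24, `ConservativeEngineConstantNormalisation.lean`
(sha256 eecf67d9…e378; CRITIC-LEDGER row 258 CLEARED (KERNEL), «landable --supports 27529 RECOMMENDED»), split in two
parts for the 400-line rule; declarations and proofs verbatim.

THIS PART (mechanism).  The amplitude–time dilation `u ↦ μ u(μ t, ·)`, `p ↦ μ² p(μ t, ·)`, `H ↦ μ H(μ t, ·)`, `0 < μ ≤ 1`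
(`dilU` / `dilP` / `dilH` = the Literature space–time rescaling toolkit `stPull μ 1 0 0` with amplitudes `μ`, `μ²`, `μ`), is a
symmetry of suitable weak Euler solutions on the slab `t < 0` (`isSuitableWeakSolutionOn_dil`, `hasWeakSpatialGradientOn_dil`:
`IsSuitableWeakSolutionOn.stRescale` / `HasWeakSpatialGradientOn.stRescale` with `α = β = μ`, `γ = 1`, `t₀ = 0`, `x₀ = 0`); it
multiplies `cknA`, `cknD` by `μ² ≤ μ` and `cknE` by `μ` because the parabolic windows `(-a², 0)` only SHRINK to `(-μ a², 0)`
(`cknA_dilU_le`, `cknE_dilH_le`, `cknD_dilP_le`, `gauge_dil_le`, `gauge_dil_le_const`); the local energy EQUALITY is covariant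
(`localEnergyEq_dil`: `integral_integral_comp_stAffine`, `timeDeriv_stPull`, `gradient_stPull`); and a.e. vanishing on `t < 0`
pulls back (`aeZero_of_aeZero_dil`: quasi-measure-preservation of `(t, x) ↦ (μ⁻¹ t, x)`).  So the class with gauge constant `c`
maps into the class with constant `μ c`, and `μ := c₀ / c` normalises.

PART 2 (`Theorems/ConservativeEngineConstantNormalisation.lean`) draws the conclusion: the existential gauge constant of
`ConservativeEngine.ConservativePowerGaugeEulerLiouville` (stmt-NavierStokesRegularity-27529) and of
`EulerZoomLiouville.PowerGaugeEulerLiouville` (stmt-NavierStokesRegularity-19832) can be frozen at ANY fixed `c₀ > 0`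
(`conservativePowerGaugeEulerLiouville_iff_fixedConstant`, `powerGaugeEulerLiouville_iff_fixedConstant`).

WHY IT MATTERS (negative knowledge for the decomposition cell decomp-ns; NOT a split — no summit / crux / stub is proved
here): the class `K_ρᶜ(c)` is star-shaped to `0` along an exact symmetry, so there is NO ε-gap / small-constant / «ε-regular»
sub-crux of X_Eᶜ — every fixed-constant engine is the crux itself; verbatim for the non-conservative parent X_E (the local
energy INEQUALITY with `ν = 0` is dilation-covariant too).  Rung currency: rung 0; nothing here proves NS regularity.
-/

noncomputable section

set_option linter.dupNamespace false

namespace Summit.NavierStokesRegularity.NavierStokesRegularity.Theorems.ConservativeEngine.ConstantNormalisation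

open MeasureTheory Set Function
open Literature.Analysis.FluidPDE
open scoped ENNReal

/-- The slab `(-∞,0) × ℝ³` as an `Opens`, exactly as in the route file. [folklore] -/
abbrev Slab : TopologicalSpace.Opens (ℝ × (EuclideanSpace ℝ (Fin 3))) :=
  Literature.Analysis.FluidPDE.slab (EuclideanSpace ℝ (Fin 3)) (Set.Iio 0) isOpen_Iio

/-- The amplitude–time dilation `u ↦ μ • u(μ t, ·)` (velocity). [folklore] -/
def dilU (μ : ℝ) (u : ℝ → (EuclideanSpace ℝ (Fin 3)) → (EuclideanSpace ℝ (Fin 3))) : ℝ → (EuclideanSpace ℝ (Fin 3)) → (EuclideanSpace ℝ (Fin 3)) := fun t x => μ • u (μ * t) x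
/-- The dilated pressure `p ↦ μ² p(μ t, ·)`. [folklore] -/
def dilP (μ : ℝ) (p : ℝ → (EuclideanSpace ℝ (Fin 3)) → ℝ) : ℝ → (EuclideanSpace ℝ (Fin 3)) → ℝ := fun t x => μ ^ 2 * p (μ * t) x
/-- The dilated weak gradient `H ↦ μ • H(μ t, ·)`. [folklore] -/
def dilH (μ : ℝ) (H : ℝ → (EuclideanSpace ℝ (Fin 3)) → (EuclideanSpace ℝ (Fin 3)) →L[ℝ] (EuclideanSpace ℝ (Fin 3))) : ℝ → (EuclideanSpace ℝ (Fin 3)) → (EuclideanSpace ℝ (Fin 3)) →L[ℝ] (EuclideanSpace ℝ (Fin 3)) :=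
  fun t x => μ • H (μ * t) x

/-- The velocity dilation is the toolkit pull-back `μ • stPull μ 1 0 0 u`. [folklore] -/
theorem dilU_eq (μ : ℝ) (u : ℝ → (EuclideanSpace ℝ (Fin 3)) → (EuclideanSpace ℝ (Fin 3))) : dilU μ u = μ • stPull μ 1 0 0 u := by
  funext t x
  simp [dilU, stPull_apply]

/-- The pressure dilation is `μ² • stPull μ 1 0 0 p`. [folklore] -/
theorem dilP_eq (μ : ℝ) (p : ℝ → (EuclideanSpace ℝ (Fin 3)) → ℝ) : dilP μ p = μ ^ 2 • stPull μ 1 0 0 p := by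
  funext t x
  simp [dilP, stPull_apply]

/-- The gradient dilation is `(μ * 1) • stPull μ 1 0 0 H` (the toolkit's `(α γ) • G ∘ Φ`). [folklore] -/
theorem dilH_eq (μ : ℝ) (H : ℝ → (EuclideanSpace ℝ (Fin 3)) → (EuclideanSpace ℝ (Fin 3)) →L[ℝ] (EuclideanSpace ℝ (Fin 3))) :
    dilH μ H = (μ * 1) • stPull μ 1 0 0 H := by
  funext t x
  simp [dilH, stPull_apply]

/-- The slab `t < 0` is invariant under the time dilation `t ↦ μ t`, `μ > 0`. [folklore] -/
theorem stPreimage_slab {μ : ℝ} (hμ : 0 < μ) : stPreimage μ 1 0 0 Slab = Slab := by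
  ext z
  simp only [SetLike.mem_coe, mem_stPreimage, mem_slab, Set.mem_Iio, stAffine_fst, zero_add]
  constructor
  · intro h
    by_contra hz
    push Not at hz
    have : 0 ≤ μ * z.1 := mul_nonneg hμ.le hz
    linarith
  · intro h
    exact mul_neg_of_pos_of_neg hμ h

/-- The standard parabolic cylinder `Q_a(0)` is the preimage of the SHORTER cylinder
`(-μ a², 0) × B_a` under `(t, x) ↦ (μ t, x)`. [folklore] -/
theorem parabolicCylinder_eq_preimage {μ : ℝ} (hμ : 0 < μ) (a : ℝ) :
    parabolicCylinder a (0 : ℝ × (EuclideanSpace ℝ (Fin 3))) =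
      stAffine μ 1 0 0 ⁻¹' (Set.Ioo (-(μ * a ^ 2)) 0 ×ˢ Metric.ball (0 : (EuclideanSpace ℝ (Fin 3))) a) := by
  rw [stAffine_preimage_cylinder hμ one_pos]
  have h1 : -(μ * a ^ 2) - 0 = μ * (-a ^ 2) := by ring
  rw [h1, mul_div_cancel_left₀ _ hμ.ne', sub_self, zero_div, sub_self, smul_zero, div_one]
  simp [parabolicCylinder]

/-- The shorter cylinder sits inside the standard one when `μ ≤ 1`. [folklore] -/
theorem short_cylinder_subset {μ : ℝ} (hμ1 : μ ≤ 1) (a : ℝ) :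
    Set.Ioo (-(μ * a ^ 2)) 0 ×ˢ Metric.ball (0 : (EuclideanSpace ℝ (Fin 3))) a ⊆ parabolicCylinder a (0 : ℝ × (EuclideanSpace ℝ (Fin 3))) := by
  intro z hz
  simp only [parabolicCylinder, Prod.fst_zero, Prod.snd_zero, zero_sub, Set.mem_prod, Set.mem_Ioo,
    Metric.mem_ball] at hz ⊢
  refine ⟨⟨?_, hz.1.2⟩, hz.2⟩
  have : μ * a ^ 2 ≤ a ^ 2 := by nlinarith [sq_nonneg a]
  linarith [hz.1.1]

/-- `μ² · μ⁻¹ = μ` in `ℝ≥0∞` (the Jacobian bookkeeping of the time dilation). [folklore] -/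
theorem ofReal_sq_mul_ofReal_inv {μ : ℝ} (hμ : 0 < μ) :
    ENNReal.ofReal (μ ^ 2) * ENNReal.ofReal μ⁻¹ = ENNReal.ofReal μ := by
  rw [← ENNReal.ofReal_mul (sq_nonneg μ), sq, mul_assoc, mul_inv_cancel₀ hμ.ne', mul_one]

/-- Gauge A under dilation: `A(a; μ u(μ·,·)) ≤ μ² A(a; u)` (the sup window only shrinks). [folklore] -/
theorem cknA_dilU_le {μ : ℝ} (hμ : 0 < μ) (hμ1 : μ ≤ 1) (a : ℝ) (u : ℝ → (EuclideanSpace ℝ (Fin 3)) → (EuclideanSpace ℝ (Fin 3))) :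
    cknA a (0 : ℝ × (EuclideanSpace ℝ (Fin 3))) (dilU μ u) ≤ ENNReal.ofReal (μ ^ 2) * cknA a (0 : ℝ × (EuclideanSpace ℝ (Fin 3))) u := by
  unfold cknA
  simp only [Prod.fst_zero, Prod.snd_zero]
  refine iSup₂_le fun t ht => ?_
  have hμt : μ * t ∈ Set.Ioo (0 - a ^ 2) 0 := by
    simp only [Set.mem_Ioo, zero_sub] at ht ⊢
    refine ⟨?_, mul_neg_of_pos_of_neg hμ ht.2⟩
    nlinarith [ht.1, ht.2]
  have hpt : ∀ x, ‖dilU μ u t x‖ₑ ^ 2 = ENNReal.ofReal (μ ^ 2) * ‖u (μ * t) x‖ₑ ^ 2 := by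
    intro x
    simp only [dilU]
    rw [enorm_smul, mul_pow, Real.enorm_eq_ofReal hμ.le, ← ENNReal.ofReal_pow hμ.le]
  simp_rw [hpt]
  rw [lintegral_const_mul' _ _ ENNReal.ofReal_ne_top, mul_left_comm]
  apply mul_le_mul_right
  exact le_iSup₂_of_le (μ * t) hμt le_rfl

/-- Gauge E under dilation: `E(a; μ H(μ·,·)) ≤ μ E(a; H)` (factor `μ²` from the amplitude,
`μ⁻¹` from the Jacobian, window shrinks). [folklore] -/
theorem cknE_dilH_le {μ : ℝ} (hμ : 0 < μ) (hμ1 : μ ≤ 1) (a : ℝ)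
    (H : ℝ → (EuclideanSpace ℝ (Fin 3)) → (EuclideanSpace ℝ (Fin 3)) →L[ℝ] (EuclideanSpace ℝ (Fin 3))) :
    cknE a (0 : ℝ × (EuclideanSpace ℝ (Fin 3))) (dilH μ H) ≤ ENNReal.ofReal μ * cknE a (0 : ℝ × (EuclideanSpace ℝ (Fin 3))) H := by
  set S : Set (ℝ × (EuclideanSpace ℝ (Fin 3))) := Set.Ioo (-(μ * a ^ 2)) 0 ×ˢ Metric.ball (0 : (EuclideanSpace ℝ (Fin 3))) a with hS
  have hJ : ENNReal.ofReal ((μ * 1) ^ 2) *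
      ENNReal.ofReal (μ * (1 : ℝ) ^ Module.finrank ℝ (EuclideanSpace ℝ (Fin 3)))⁻¹ = ENNReal.ofReal μ := by
    rw [mul_one, one_pow, mul_one, ofReal_sq_mul_ofReal_inv hμ]
  calc cknE a (0 : ℝ × (EuclideanSpace ℝ (Fin 3))) (dilH μ H)
      = (ENNReal.ofReal a)⁻¹ * ∫⁻ q in stAffine μ 1 0 0 ⁻¹' S,
          ENNReal.ofReal (frobeniusNormSq (((μ * 1) • stPull μ 1 0 0 H) q.1 q.2)) := by
        rw [cknE, dilH_eq, ← parabolicCylinder_eq_preimage hμ a]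
    _ = (ENNReal.ofReal a)⁻¹ * (ENNReal.ofReal μ *
          ∫⁻ q in S, ENNReal.ofReal (frobeniusNormSq (H q.1 q.2))) := by
        rw [setLIntegral_frobeniusNormSq_stRescale hμ one_pos 0 0 (μ * 1) H S, hJ]
    _ ≤ (ENNReal.ofReal a)⁻¹ * (ENNReal.ofReal μ *
          ∫⁻ q in parabolicCylinder a (0 : ℝ × (EuclideanSpace ℝ (Fin 3))), ENNReal.ofReal (frobeniusNormSq (H q.1 q.2))) := by
        apply mul_le_mul_right
        exact mul_le_mul_right (lintegral_mono_set (short_cylinder_subset hμ1 a)) _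
    _ = ENNReal.ofReal μ * cknE a (0 : ℝ × (EuclideanSpace ℝ (Fin 3))) H := by
        rw [cknE, mul_left_comm]

/-- Gauge D under dilation: `D(a; μ² p(μ·,·)) ≤ μ D(a; p)` (factor `(μ²)^{3/2} ≤ μ²` from the
amplitude since `μ ≤ 1`, `μ⁻¹` from the Jacobian, window shrinks). [folklore] -/
theorem cknD_dilP_le {μ : ℝ} (hμ : 0 < μ) (hμ1 : μ ≤ 1) (a : ℝ) (p : ℝ → (EuclideanSpace ℝ (Fin 3)) → ℝ) :
    cknD a (0 : ℝ × (EuclideanSpace ℝ (Fin 3))) (dilP μ p) ≤ ENNReal.ofReal μ * cknD a (0 : ℝ × (EuclideanSpace ℝ (Fin 3))) p := by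
  set S : Set (ℝ × (EuclideanSpace ℝ (Fin 3))) := Set.Ioo (-(μ * a ^ 2)) 0 ×ˢ Metric.ball (0 : (EuclideanSpace ℝ (Fin 3))) a with hS
  have hμ2le : ‖μ ^ 2‖ₑ ≤ 1 := by
    rw [Real.enorm_eq_ofReal (sq_nonneg μ)]
    exact ENNReal.ofReal_le_one.2 (by nlinarith)
  have hJ : ‖μ ^ 2‖ₑ ^ (3 / 2 : ℝ) *
      ENNReal.ofReal (μ * (1 : ℝ) ^ Module.finrank ℝ (EuclideanSpace ℝ (Fin 3)))⁻¹ ≤ ENNReal.ofReal μ := by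
    rw [one_pow, mul_one]
    calc ‖μ ^ 2‖ₑ ^ (3 / 2 : ℝ) * ENNReal.ofReal μ⁻¹
        ≤ ‖μ ^ 2‖ₑ * ENNReal.ofReal μ⁻¹ := by
          gcongr
          exact ENNReal.rpow_le_self_of_le_one hμ2le (by norm_num)
      _ = ENNReal.ofReal μ := by
          rw [Real.enorm_eq_ofReal (sq_nonneg μ), ofReal_sq_mul_ofReal_inv hμ]
  calc cknD a (0 : ℝ × (EuclideanSpace ℝ (Fin 3))) (dilP μ p)
      = (ENNReal.ofReal a ^ 2)⁻¹ * ∫⁻ q in stAffine μ 1 0 0 ⁻¹' S,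
          ‖(μ ^ 2 • stPull μ 1 0 0 p) q.1 q.2‖ₑ ^ (3 / 2 : ℝ) := by
        rw [cknD, dilP_eq, ← parabolicCylinder_eq_preimage hμ a]
    _ = (ENNReal.ofReal a ^ 2)⁻¹ * (‖μ ^ 2‖ₑ ^ (3 / 2 : ℝ) *
          ENNReal.ofReal (μ * (1 : ℝ) ^ Module.finrank ℝ (EuclideanSpace ℝ (Fin 3)))⁻¹ *
          ∫⁻ q in S, ‖p q.1 q.2‖ₑ ^ (3 / 2 : ℝ)) := by
        rw [setLIntegral_enorm_rpow_stRescale hμ one_pos 0 0 (μ ^ 2) p S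
          (by norm_num : (0 : ℝ) ≤ 3 / 2)]
    _ ≤ (ENNReal.ofReal a ^ 2)⁻¹ * (ENNReal.ofReal μ *
          ∫⁻ q in parabolicCylinder a (0 : ℝ × (EuclideanSpace ℝ (Fin 3))), ‖p q.1 q.2‖ₑ ^ (3 / 2 : ℝ)) := by
        apply mul_le_mul_right
        calc ‖μ ^ 2‖ₑ ^ (3 / 2 : ℝ) * ENNReal.ofReal (μ * (1 : ℝ) ^ Module.finrank ℝ (EuclideanSpace ℝ (Fin 3)))⁻¹ *
              ∫⁻ q in S, ‖p q.1 q.2‖ₑ ^ (3 / 2 : ℝ)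
            ≤ ENNReal.ofReal μ * ∫⁻ q in S, ‖p q.1 q.2‖ₑ ^ (3 / 2 : ℝ) :=
              mul_le_mul_left hJ _
          _ ≤ ENNReal.ofReal μ *
              ∫⁻ q in parabolicCylinder a (0 : ℝ × (EuclideanSpace ℝ (Fin 3))), ‖p q.1 q.2‖ₑ ^ (3 / 2 : ℝ) :=
              mul_le_mul_right (lintegral_mono_set (short_cylinder_subset hμ1 a)) _
    _ = ENNReal.ofReal μ * cknD a (0 : ℝ × (EuclideanSpace ℝ (Fin 3))) p := by
        rw [cknD, mul_left_comm]

/-- The weighted gauge sum of the dilated triple is at most `μ` times that of the original. [folklore] -/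
theorem gauge_dil_le {μ : ℝ} (hμ : 0 < μ) (hμ1 : μ ≤ 1) (ρ a : ℝ) (u : ℝ → (EuclideanSpace ℝ (Fin 3)) → (EuclideanSpace ℝ (Fin 3)))
    (p : ℝ → (EuclideanSpace ℝ (Fin 3)) → ℝ) (H : ℝ → (EuclideanSpace ℝ (Fin 3)) → (EuclideanSpace ℝ (Fin 3)) →L[ℝ] (EuclideanSpace ℝ (Fin 3))) :
    ENNReal.ofReal (a ^ (2 * ρ)) * cknA a (0 : ℝ × (EuclideanSpace ℝ (Fin 3))) (dilU μ u) +
      ENNReal.ofReal (a ^ ρ) * cknE a (0 : ℝ × (EuclideanSpace ℝ (Fin 3))) (dilH μ H) +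
      ENNReal.ofReal (a ^ (2 * ρ)) * cknD a (0 : ℝ × (EuclideanSpace ℝ (Fin 3))) (dilP μ p) ≤
    ENNReal.ofReal μ * (ENNReal.ofReal (a ^ (2 * ρ)) * cknA a (0 : ℝ × (EuclideanSpace ℝ (Fin 3))) u +
      ENNReal.ofReal (a ^ ρ) * cknE a (0 : ℝ × (EuclideanSpace ℝ (Fin 3))) H +
      ENNReal.ofReal (a ^ (2 * ρ)) * cknD a (0 : ℝ × (EuclideanSpace ℝ (Fin 3))) p) := by
  have hμ2 : ENNReal.ofReal (μ ^ 2) ≤ ENNReal.ofReal μ := ENNReal.ofReal_le_ofReal (by nlinarith)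
  have hA : cknA a (0 : ℝ × (EuclideanSpace ℝ (Fin 3))) (dilU μ u) ≤ ENNReal.ofReal μ * cknA a (0 : ℝ × (EuclideanSpace ℝ (Fin 3))) u :=
    (cknA_dilU_le hμ hμ1 a u).trans (mul_le_mul_left hμ2 _)
  have hE := cknE_dilH_le hμ hμ1 a H
  have hD := cknD_dilP_le hμ hμ1 a p
  calc _ ≤ ENNReal.ofReal (a ^ (2 * ρ)) * (ENNReal.ofReal μ * cknA a (0 : ℝ × (EuclideanSpace ℝ (Fin 3))) u) +
        ENNReal.ofReal (a ^ ρ) * (ENNReal.ofReal μ * cknE a (0 : ℝ × (EuclideanSpace ℝ (Fin 3))) H) +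
        ENNReal.ofReal (a ^ (2 * ρ)) * (ENNReal.ofReal μ * cknD a (0 : ℝ × (EuclideanSpace ℝ (Fin 3))) p) := by
        gcongr
    _ = _ := by ring

/-- Local energy equality is dilation-covariant: the identity for the dilated triple tested with
`φ` is `μ²` times the identity for `(u, p)` tested with `φ(·/μ, ·)`. [folklore] -/
theorem localEnergyEq_dil {μ : ℝ} (hμ : 0 < μ) (u : ℝ → (EuclideanSpace ℝ (Fin 3)) → (EuclideanSpace ℝ (Fin 3))) (p : ℝ → (EuclideanSpace ℝ (Fin 3)) → ℝ)
    (hle : ∀ φ : ℝ → (EuclideanSpace ℝ (Fin 3)) → ℝ, IsSpaceTimeTestOn Slab φ →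
      ∫ t, ∫ x, (‖u t x‖ ^ 2 * timeDeriv φ t x +
        (‖u t x‖ ^ 2 + 2 * p t x) * inner ℝ (u t x) (gradient (φ t) x)) = 0) :
    ∀ φ : ℝ → (EuclideanSpace ℝ (Fin 3)) → ℝ, IsSpaceTimeTestOn Slab φ →
      ∫ t, ∫ x, (‖dilU μ u t x‖ ^ 2 * timeDeriv φ t x +
        (‖dilU μ u t x‖ ^ 2 + 2 * dilP μ p t x) *
          inner ℝ (dilU μ u t x) (gradient (φ t) x)) = 0 := by
  intro φ hφ
  have hφ' : IsSpaceTimeTestOn (stPreimage μ 1 0 0 Slab) φ := by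
    rw [stPreimage_slab hμ]; exact hφ
  set φ' := stPull μ⁻¹ (1 : ℝ)⁻¹ (-(μ⁻¹ * 0)) (-((1 : ℝ)⁻¹ • (0 : (EuclideanSpace ℝ (Fin 3))))) φ with hφ'def
  have hφ'Q : IsSpaceTimeTestOn Slab φ' := hφ'.stPull_symm hμ.ne' one_ne_zero
  have hrepr : φ = stPull μ 1 0 0 φ' := (stPull_stPull_symm hμ.ne' one_ne_zero 0 0 φ).symm
  have hzero := hle φ' hφ'Q
  set F : ℝ → (EuclideanSpace ℝ (Fin 3)) → ℝ := fun t x => ‖u t x‖ ^ 2 * timeDeriv φ' t x +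
    (‖u t x‖ ^ 2 + 2 * p t x) * inner ℝ (u t x) (gradient (φ' t) x) with hF
  have hzero' : ∫ t, ∫ x, F t x = 0 := hzero
  have key : ∀ t x, (‖dilU μ u t x‖ ^ 2 * timeDeriv φ t x +
      (‖dilU μ u t x‖ ^ 2 + 2 * dilP μ p t x) * inner ℝ (dilU μ u t x) (gradient (φ t) x)) =
      μ ^ 3 * F (0 + μ * t) (0 + (1 : ℝ) • x) := by
    intro t x
    conv_lhs => rw [hrepr]
    rw [timeDeriv_stPull, gradient_stPull]
    simp only [hF, dilU, dilP, zero_add, one_smul, smul_eq_mul, norm_smul, Real.norm_eq_abs,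
      abs_of_pos hμ, real_inner_smul_left, mul_pow]
    ring
  simp_rw [key, integral_const_mul]
  rw [integral_integral_comp_stAffine hμ one_pos 0 0 F, hzero', smul_zero, mul_zero]

/-- The dilated pair is again a suitable weak Euler solution on the slab (`IsSuitableWeakSolutionOn.stRescale` with
`α = β = μ`, `γ = 1`; the slab is dilation-invariant, the force stays `0`, the viscosity stays `0`). [folklore] -/
theorem isSuitableWeakSolutionOn_dil {μ : ℝ} (hμ : 0 < μ) {u : ℝ → (EuclideanSpace ℝ (Fin 3)) → (EuclideanSpace ℝ (Fin 3))} {p : ℝ → (EuclideanSpace ℝ (Fin 3)) → ℝ}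
    (hsw : IsSuitableWeakSolutionOn Slab 0 0 u p) :
    IsSuitableWeakSolutionOn Slab 0 0 (dilU μ u) (dilP μ p) := by
  have hβ : μ = μ * 1 := (mul_one μ).symm
  have h1' := hsw.stRescale hμ one_pos hβ 0 0
  have e0 : (μ * 0 / 1 : ℝ) = 0 := by ring
  have ef : ((μ ^ 2 * 1) • stPull μ 1 0 0 (0 : ℝ → (EuclideanSpace ℝ (Fin 3)) → (EuclideanSpace ℝ (Fin 3)))) = 0 := by
    funext t x
    simp [stPull_apply]
  rw [stPreimage_slab hμ, e0, ef, ← dilU_eq, ← dilP_eq] at h1'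
  exact h1'

/-- The dilated gradient is a weak spatial gradient of the dilated field (`HasWeakSpatialGradientOn.stRescale`). [folklore] -/
theorem hasWeakSpatialGradientOn_dil {μ : ℝ} (hμ : 0 < μ) {u : ℝ → (EuclideanSpace ℝ (Fin 3)) → (EuclideanSpace ℝ (Fin 3))}
    {H : ℝ → (EuclideanSpace ℝ (Fin 3)) → (EuclideanSpace ℝ (Fin 3)) →L[ℝ] (EuclideanSpace ℝ (Fin 3))} (hH : HasWeakSpatialGradientOn Slab u H) :
    HasWeakSpatialGradientOn Slab (dilU μ u) (dilH μ H) := by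
  have h2' := hH.stRescale μ hμ one_pos 0 0
  rw [stPreimage_slab hμ, ← dilU_eq, ← dilH_eq] at h2'
  exact h2'

/-- The gauge bound with constant `c` becomes the gauge bound with constant `μ c`. [folklore] -/
theorem gauge_dil_le_const {μ : ℝ} (hμ : 0 < μ) (hμ1 : μ ≤ 1) {ρ : ℝ} {u : ℝ → (EuclideanSpace ℝ (Fin 3)) → (EuclideanSpace ℝ (Fin 3))}
    {p : ℝ → (EuclideanSpace ℝ (Fin 3)) → ℝ} {H : ℝ → (EuclideanSpace ℝ (Fin 3)) → (EuclideanSpace ℝ (Fin 3)) →L[ℝ] (EuclideanSpace ℝ (Fin 3))} {c : NNReal}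
    (hg : ∀ a : ℝ, 0 < a →
      ENNReal.ofReal (a ^ (2 * ρ)) * cknA a (0 : ℝ × (EuclideanSpace ℝ (Fin 3))) u +
      ENNReal.ofReal (a ^ ρ) * cknE a (0 : ℝ × (EuclideanSpace ℝ (Fin 3))) H +
      ENNReal.ofReal (a ^ (2 * ρ)) * cknD a (0 : ℝ × (EuclideanSpace ℝ (Fin 3))) p ≤ (c : ENNReal)) :
    ∀ a : ℝ, 0 < a →
      ENNReal.ofReal (a ^ (2 * ρ)) * cknA a (0 : ℝ × (EuclideanSpace ℝ (Fin 3))) (dilU μ u) +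
      ENNReal.ofReal (a ^ ρ) * cknE a (0 : ℝ × (EuclideanSpace ℝ (Fin 3))) (dilH μ H) +
      ENNReal.ofReal (a ^ (2 * ρ)) * cknD a (0 : ℝ × (EuclideanSpace ℝ (Fin 3))) (dilP μ p) ≤
        ((Real.toNNReal μ * c : NNReal) : ENNReal) := by
  intro a ha
  refine (gauge_dil_le hμ hμ1 ρ a u p H).trans ?_
  have hcoe : ((Real.toNNReal μ * c : NNReal) : ENNReal) = ENNReal.ofReal μ * (c : ENNReal) := by
    rw [ENNReal.coe_mul]
    rfl
  rw [hcoe]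
  exact mul_le_mul_right (hg a ha) _

/-- A.e. vanishing on `t < 0` pulls back through the dilation: the inverse map `(t, x) ↦ (μ⁻¹ t, x)` is
quasi-measure-preserving and maps the slab to itself. [folklore] -/
theorem aeZero_of_aeZero_dil {μ : ℝ} (hμ : 0 < μ) (u : ℝ → (EuclideanSpace ℝ (Fin 3)) → (EuclideanSpace ℝ (Fin 3)))
    (h : Function.uncurry (dilU μ u) =ᵐ[volume.restrict (Set.Iio (0 : ℝ) ×ˢ (Set.univ : Set (EuclideanSpace ℝ (Fin 3))))] 0) :
    Function.uncurry u =ᵐ[volume.restrict (Set.Iio (0 : ℝ) ×ˢ (Set.univ : Set (EuclideanSpace ℝ (Fin 3))))] 0 := by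
  have hμ0 : μ ≠ 0 := hμ.ne'
  have h1 : (fun z : ℝ × (EuclideanSpace ℝ (Fin 3)) => Function.uncurry u (μ * z.1, z.2))
      =ᵐ[volume.restrict (Set.Iio (0 : ℝ) ×ˢ (Set.univ : Set (EuclideanSpace ℝ (Fin 3))))] (0 : ℝ × (EuclideanSpace ℝ (Fin 3)) → (EuclideanSpace ℝ (Fin 3))) := by
    filter_upwards [h] with z hz
    have hz' : μ • u (μ * z.1) z.2 = 0 := by
      simpa [dilU, Function.uncurry] using hz
    have := (smul_eq_zero.mp hz').resolve_left hμ0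
    simpa [Function.uncurry] using this
  set S : Set (ℝ × (EuclideanSpace ℝ (Fin 3))) := Set.Iio (0 : ℝ) ×ˢ (Set.univ : Set (EuclideanSpace ℝ (Fin 3))) with hS
  have hq : Measure.QuasiMeasurePreserving (Prod.map (fun t : ℝ => μ⁻¹ * t) (id : (EuclideanSpace ℝ (Fin 3)) → (EuclideanSpace ℝ (Fin 3))))
      (volume : Measure (ℝ × (EuclideanSpace ℝ (Fin 3)))) volume := by
    rw [MeasureTheory.Measure.volume_eq_prod]
    refine MeasureTheory.QuasiMeasurePreserving.prodMap ?_ (Measure.QuasiMeasurePreserving.id _)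
    refine ⟨measurable_const_mul _, ?_⟩
    rw [Real.map_volume_mul_left (inv_ne_zero hμ0)]
    exact Measure.smul_absolutelyContinuous
  have hmaps : Set.MapsTo (Prod.map (fun t : ℝ => μ⁻¹ * t) (id : (EuclideanSpace ℝ (Fin 3)) → (EuclideanSpace ℝ (Fin 3)))) S S := by
    intro z hz
    simp only [hS, Set.mem_prod, Set.mem_Iio, Set.mem_univ, and_true, Prod.map] at hz ⊢
    exact mul_neg_of_pos_of_neg (inv_pos.mpr hμ) hz
  have hT := hq.restrict hmaps
  have h2 := hT.ae_eq_comp h1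
  refine h2.mono ?_
  intro z hz
  simpa [Function.comp, Prod.map, mul_inv_cancel_left₀ hμ0, Function.uncurry] using hz

end Summit.NavierStokesRegularity.NavierStokesRegularity.Theorems.ConservativeEngine.ConstantNormalisation

end
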